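import Summits.QuantumFields.YangMills.Theorems.BalabanUVNodesN11Sect3SupplyChainRows
import Summits.QuantumFields.YangMills.Theorems.BalabanUVNodesN11NoExpansionClauseGaussCertWitness

/-!
# DAG node N11 — DEFINITIONS: THE WITNESS CHAIN's HAND-OVER LIST, NAMED — the chain's inductive hypothesis `ChainFormAt`, the SUPPLIER's OBLIGATIONS ALONG ITS OWN CHAIN
# `SupplierObligations` ([III] §3's content), the no-expansion obligation `NoExpansionObligation` (dag-n11-d's lane), def-T's OPERAND ROWS `OperandRowsAt ∕ OperandRowsAlongChain`
# and the witness-free RESIDUAL ROWS `ResidualRowsAt ∕ ResidualRows` (K0b ∕ def-T data); Theorem 1 along the chain and its 𝐓-image read through the names; the no-expansion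
# obligation DISCHARGED from the rows (dag-n11-d) or, at a Gaussian certificate, from the operand rows alone (dag-n11-w1)

Cell `pub-ymgap`, YM-PLAN Track A (HUMAN RULING D-0062 ∕ D-0149), seat `pub-ymgap-dag-n11-e` (g16; R134 fan-out row N11∕s3), route `BalabanUVNodes` rev 25 (v1.7 `CoPH` key), item
K1⁷ `StabilityBAtRecordR13SepCoPH` = stmt-QuantumFields-20542 (helper, DEFINITION lane, count-neutral).  [III] = [Balaban1988Convergent], [IV] = [Balaban1989LargeFieldI].
Sequel of this seat's `…Sect3SupplyChainDefs ∕ …Sect3SupplyChain ∕ …Sect3SupplyChainRows` (p591185 ∕ p591271 ∕ p592483) and of dag-n11-w1's witness-keyed Gaussian face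
`…NoExpansionClauseGaussCertWitness.clause_succ_of_gaussCert_of_witness` (p592749).

WHY THIS FILE.  `…Sect3SupplyChain.formAtZS_chainWitness` and `…ChainRows.sLaw₁₃CoPH_all_of_chain_of_rows` display FIVE hypothesis families, each four to thirty lines long and
each re-spelled by every consumer (node faces, door editions, Gaussian editions, the p.244-keyed twins of dag-n11-w3).  This file NAMES them once — nothing is weakened or
strengthened, every definition is the displayed text VERBATIM (`Iff.rfl` faces) — and sorts them by OWNER:
* `ChainFormAt θ p σ k` — the chain's level-`k` witness HAS the §2 form of `ρ_k` (print's inductive hypothesis «the terms constructed so far satisfy (2.23)–(2.42)»);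
  `ChainFormTAt θ p σ k` — the level-`(k+1)` chain witness IS a 𝐓-image witness at level `k` (laws `Sect2.LawsT … k`, clause at the pre-𝐑 slots `𝐓ρ_k`).
* `SupplierObligations θ p σ` — WHAT [III] §3 MUST DELIVER, keyed to the supplier's OWN chain: (loc) its responses are `(k+1)`-local in the fluctuation variables, (univE)
  universal in 𝐄, (newE) the four 𝐄-clauses, (present) `PresentChildObligations` at the 𝐓-present expansion children — each may assume `ChainFormAt θ p σ k`.
* `NoExpansionObligation θ p σ` — dag-n11-d's no-expansion clause for the chain's witness (their lane; DISCHARGED in §5 two ways).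
* `SupplyChainAt θ p` — N11's RESIDUAL AT `(θ, p)` IN ONE TOKEN: `∃ σ, SupplierObligations θ p σ ∧ NoExpansionObligation θ p σ`.
* `OperandRowsAt θ p k s′ t₀ E₀` — def-T ∕ def-R's two operand rows (measurability + upper bound of `exp A_k(init s′)[t₀, E₀]` on the multiscale configuration space) for ONE
  witness value; `OperandRowsAlongChain θ p σ` — the same for the chain's witness at the no-expansion histories with a present parent.
* `ResidualRowsAt θ p k s′` — WITNESS-FREE data rows at a no-expansion history (dag-n11-d's specification: the four pins of the general step, measurability of the residual
  serving `s′`, K0b's A-fibre domination); `ResidualRows θ p` — at every no-expansion history with a present parent.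
§4 reads Theorem 1 along the chain (`chainFormAt_all_of_obligations`, `sLaw₁₃CoPH_all_of_obligations`) AND ITS 𝐓-IMAGE (`chainFormTAt_of_chainFormAt`, ★ `tLaw₁₃CoPH_all_of_obligations`,
★ `thmP245Laws_of_obligations` — the law form of the Theorem of p. 245, the input of every node dictionary) through the names; §5 discharges `NoExpansionObligation` from
`ResidualRows + OperandRowsAlongChain` (dag-n11-d's rows, `…ChainRows` §1) and — ★★ — at any `θ` of the GAUSSIAN CERTIFICATE CLASS from `OperandRowsAlongChain` ALONE
(dag-n11-w1's p592749; no `ZhUnity`, no K0b row, no residual row).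

HONEST FRAMING.  Definitions naming displayed hypotheses + kernel composition of landed theorems; every obligation and row DISPLAYED, none discharged except where §5 says by whom;
nothing of Bałaban asserted; N11 NOT discharged; K1⁷ NOT closed; counts unmoved (typed 28∕28 · discharged 5∕27).  One finite `𝕋⁴_{L^K}` programme at fixed `ε = L^{−K}`;
NOT ℝ⁴, NOT OS, NOT a mass gap, NOT Clay.  No `sorry`, `axiom`, `instance`, `notation`.
Sources (SHAPE only): [III] Theorem p.245, Thm 1 p.262, Thm 2 p.263, §3 p.279, (3.24)–(3.25) p.270, (3.1) p.264, (2.18) p.257, (2.20)–(2.23) p.258, (2.27)–(2.31) pp.259–260,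
(2.40)–(2.42) p.261, (3.16)–(3.23) pp.268–270; [IV] (0.2)–(0.4) p.176, p.177 (i)–(ii).
-/

noncomputable section

open MeasureTheory
open scoped BigOperators ENNReal NNReal Matrix.Norms.L2Operator

namespace Summit.QuantumFields.YangMills.Theorems.BalabanUVNodesN11Sect3SupplyChainObligationsDefs

open Literature.MathematicalPhysics.QuantumFieldTheory.Balaban1983to89 T4Continuum Node00 Node00.Tk
open B10Eq42TorusConstraint (bondsIn)
open BalabanUVNodesN11HistoryPinnedResidualDefs (ZhPinOfRecord₁₃)
open BalabanUVNodesN11FluctTruncationDefs (IsFluctLocal)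
open BalabanUVNodesN11Sect3SupplyPresentParents (slotsTOfRecord₁₃H_succ_eq_zero_of_init_eq_zero)
open BalabanUVNodesN11Sect3SupplyChainDefs
open BalabanUVNodesN11Sect3SupplyChain (formAtZS_chainWitness formT_spliceTermsB_of_rows)
open BalabanUVNodesN11Sect3SupplyChainRows (noExpansionClauseFor_of_form_of_local_of_rows)
open BalabanUVNodesN11NoExpansionClauseGaussCertWitness (clause_succ_of_gaussCert_of_witness)

variable {F : T4Family} {N : ℕ} [NeZero N]
variable (θ : Stage13HParams F N) (p : B12.RunParams)

/-! ## §1  The chain's inductive hypothesis and its 𝐓-image, named -/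

section Form

/-- **THE CHAIN's LEVEL-`k` WITNESS HAS THE §2 FORM OF `ρ_k`** (def-T's `HasSect2FormAtZS` at index `k`, laws `Sect2.LawsRT … k`, post-𝐑 slots of record, AT the named witness
`chainWitness θ p σ k`) — print's inductive hypothesis of §3 on «the terms constructed so far».  The displayed antecedent of every per-level hand-over, VERBATIM.
[cite: Balaban1988Convergent, Thm 1 p.262, (2.18) p.257, (2.23) p.258, §3 p.279] -/
def ChainFormAt (σ : Sect3Supplier θ p) (k : ℕ) : Prop :=
  HasSect2FormAtZS F N (FluctV N) p.K (settingOfRecord₁₃ F N θ.toStage13Params p) k (θ.rzAt p) (WtOfRecord₁₃H F N θ p) (UbgOfRecord₁₃CoP F N θ.toStage13Params p k)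
    (fun s u => Sect2.LawsRT (sect2TowerOfRecord F N (FluctV N) p.K (settingOfRecord₁₃ F N θ.toStage13Params p) (θ.rzAt p s) s u) (settingOfRecord₁₃ F N θ.toStage13Params p).lf k)
    (slotsOfRecord F N θ.ν θ.τ9 (EOfRecord₁₃ F N θ.toStage13Params) (wOfRecord₉ F N θ.toStage9Params) θ.ppSel p (gOfRecord₁₃ F N θ.toStage13Params p) k)
    (chainWitness θ p σ k).1 (chainWitness θ p σ k).2

/-- **THE CHAIN's LEVEL-`(k+1)` WITNESS IS A 𝐓-IMAGE WITNESS AT LEVEL `k`** (def-T's `HasSect2FormAtZS` at length `k+1` with the laws `Sect2.LawsT … k` and the PRE-𝐑 slots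
`𝐓ρ_k` of record) — the body of `TLaw₁₃CoPH θ p k` at the named witness (the splice of the level-`k` chain witness with the supplier's response).
[cite: Balaban1988Convergent, remark p.262, §3 p.279, (3.24)–(3.25) p.270] -/
def ChainFormTAt (σ : Sect3Supplier θ p) (k : ℕ) : Prop :=
  HasSect2FormAtZS F N (FluctV N) p.K (settingOfRecord₁₃ F N θ.toStage13Params p) (k + 1) (θ.rzAt p) (WtOfRecord₁₃H F N θ p) (UbgOfRecord₁₃CoP F N θ.toStage13Params p (k + 1))
    (fun s u => Sect2.LawsT (sect2TowerOfRecord F N (FluctV N) p.K (settingOfRecord₁₃ F N θ.toStage13Params p) (θ.rzAt p s) s u) (settingOfRecord₁₃ F N θ.toStage13Params p).lf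
      (settingOfRecord₁₃ F N θ.toStage13Params p).βc k)
    (slotsTOfRecord F N θ.ν θ.τ9 (EOfRecord₁₃ F N θ.toStage13Params) (wOfRecord₉ F N θ.toStage9Params) θ.ppSel p (gOfRecord₁₃ F N θ.toStage13Params p) (k + 1))
    (chainWitness θ p σ (k + 1)).1 (chainWitness θ p σ (k + 1)).2

variable {θ p}

/-- `ChainFormAt` unfolds to the displayed form (`Iff.rfl`). [cite: Balaban1988Convergent, Thm 1 p.262 (bookkeeping)] -/
theorem chainFormAt_iff (σ : Sect3Supplier θ p) (k : ℕ) :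
    ChainFormAt θ p σ k ↔
      HasSect2FormAtZS F N (FluctV N) p.K (settingOfRecord₁₃ F N θ.toStage13Params p) k (θ.rzAt p) (WtOfRecord₁₃H F N θ p) (UbgOfRecord₁₃CoP F N θ.toStage13Params p k)
        (fun s u => Sect2.LawsRT (sect2TowerOfRecord F N (FluctV N) p.K (settingOfRecord₁₃ F N θ.toStage13Params p) (θ.rzAt p s) s u) (settingOfRecord₁₃ F N θ.toStage13Params p).lf k)
        (slotsOfRecord F N θ.ν θ.τ9 (EOfRecord₁₃ F N θ.toStage13Params) (wOfRecord₉ F N θ.toStage9Params) θ.ppSel p (gOfRecord₁₃ F N θ.toStage13Params p) k)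
        (chainWitness θ p σ k).1 (chainWitness θ p σ k).2 := Iff.rfl

/-- `ChainFormTAt` unfolds to the displayed 𝐓-image form of the splice pair (`Iff.rfl`; `chainWitness_succ`). [cite: Balaban1988Convergent, §3 p.279 (bookkeeping)] -/
theorem chainFormTAt_iff (σ : Sect3Supplier θ p) (k : ℕ) :
    ChainFormTAt θ p σ k ↔
      HasSect2FormAtZS F N (FluctV N) p.K (settingOfRecord₁₃ F N θ.toStage13Params p) (k + 1) (θ.rzAt p) (WtOfRecord₁₃H F N θ p) (UbgOfRecord₁₃CoP F N θ.toStage13Params p (k + 1))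
        (fun s u => Sect2.LawsT (sect2TowerOfRecord F N (FluctV N) p.K (settingOfRecord₁₃ F N θ.toStage13Params p) (θ.rzAt p s) s u) (settingOfRecord₁₃ F N θ.toStage13Params p).lf
          (settingOfRecord₁₃ F N θ.toStage13Params p).βc k)
        (slotsTOfRecord F N θ.ν θ.τ9 (EOfRecord₁₃ F N θ.toStage13Params) (wOfRecord₉ F N θ.toStage9Params) θ.ppSel p (gOfRecord₁₃ F N θ.toStage13Params p) (k + 1))
        (spliceTermsB θ p k (chainWitness θ p σ k).1 (σ k (chainWitness θ p σ k).1 (chainWitness θ p σ k).2).1)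
        (spliceConst θ p k (chainWitness θ p σ k).2 (σ k (chainWitness θ p σ k).1 (chainWitness θ p σ k).2).2) := Iff.rfl

/-- Level `0` of the chain HAS the form (def-T's `sLaw₁₃CoPH_zero`, read at `baseWitness`). [cite: Balaban1988Convergent, Thm 1 p.262, (2.18) p.257] -/
theorem chainFormAt_zero (σ : Sect3Supplier θ p) : ChainFormAt θ p σ 0 := baseWitness_form θ p

/-- `ChainFormAt θ p σ k` gives `SLaw₁₃CoPH θ p k` (def-T's `sLaw₁₃CoPH_iff`). [cite: Balaban1988Convergent, Thm 1 p.262, (2.18) p.257] -/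
theorem sLaw₁₃CoPH_of_chainFormAt {σ : Sect3Supplier θ p} {k : ℕ} (h : ChainFormAt θ p σ k) : SLaw₁₃CoPH F N θ p k :=
  (sLaw₁₃CoPH_iff F N θ p k).mpr ⟨_, _, h⟩

/-- `ChainFormTAt θ p σ k` gives `TLaw₁₃CoPH θ p k` (def-T's `tLaw₁₃CoPH_iff`). [cite: Balaban1988Convergent, remark p.262, (3.25) p.270] -/
theorem tLaw₁₃CoPH_of_chainFormTAt {σ : Sect3Supplier θ p} {k : ℕ} (h : ChainFormTAt θ p σ k) : TLaw₁₃CoPH F N θ p k :=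
  (tLaw₁₃CoPH_iff F N θ p k).mpr ⟨_, _, h⟩

end Form

/-! ## §2  The supplier's obligations along its own chain ([III] §3's content, named) and the no-expansion obligation (dag-n11-d's lane, named) -/

section Obligations


/-- **THE SUPPLIER's OBLIGATIONS ALONG ITS OWN CHAIN — WHAT [III] §3 MUST DELIVER**, keyed to the supplier's own constructed terms: (loc) every response is `(k+1)`-local in the
fluctuation variables ((2.40)–(2.41): `𝐁^{(k+1)}` reads fluctuation fields of generations `≤ k+1`); and, per level `k < K`, GIVEN the inductive hypothesis `ChainFormAt θ p σ k`:
(univE) the response is universal in 𝐄; (newE) the four level-`(k+1)` 𝐄-clauses at every history; (present) `PresentChildObligations` at every 𝐓-present expansion child ((O1′)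
its own `𝐁^{(k)}` on the child's space, (O2) r11's new-term obligations `Step.LFNewTerms` + analyticity at `k+1` — the inductive bounds (2.28) ∕ (2.31) ∕ (2.42) for the NEW terms,
«the corresponding space» of Def. p.279 —, (O3′) the 𝐓-image identity for the splice).  The four displayed hypothesis families of `…Sect3SupplyChain.formAtZS_chainWitness` ∕
`…ChainRows`, VERBATIM.  Nothing claimed: a structure of hypotheses.
[cite: Balaban1988Convergent, Thm 1 p.262, §3 p.279, (3.24)–(3.25) p.270, (2.27)–(2.31) pp.259–260, (2.38)–(2.42) p.261] -/
structure SupplierObligations (σ : Sect3Supplier θ p) : Prop where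
  /-- (loc) every response is `(k+1)`-local in the fluctuation variables. -/
  loc : ∀ k (s : SeqOfRecord F θ.ν θ.τ9.M (gOfRecord₁₃ F N θ.toStage13Params p) p.K (k + 1)), IsFluctLocal (k + 1) ((σ k (chainWitness θ p σ k).1 (chainWitness θ p σ k).2).1 s)
  /-- (univE) the response is universal in 𝐄. -/
  univE : ∀ k, k < p.K → ChainFormAt θ p σ k → Sect2.UniversalE (σ k (chainWitness θ p σ k).1 (chainWitness θ p σ k).2).1
  /-- (newE) the four level-`(k+1)` 𝐄-clauses at every history of length `k+1`. -/
  newE : ∀ k, k < p.K → ChainFormAt θ p σ k →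
    ∀ s : SeqOfRecord F θ.ν θ.τ9.M (gOfRecord₁₃ F N θ.toStage13Params p) p.K (k + 1), NewEClausesAt θ p k ((σ k (chainWitness θ p σ k).1 (chainWitness θ p σ k).2).1 s) s
  /-- (present) the obligations at every 𝐓-present expansion child. -/
  present : ∀ k, k < p.K → ChainFormAt θ p σ k →
    ∀ s : SeqOfRecord F θ.ν θ.τ9.M (gOfRecord₁₃ F N θ.toStage13Params p) p.K (k + 1), s.Ω (k + 1) ≠ ∅ →
      slotsTOfRecord F N θ.ν θ.τ9 (EOfRecord₁₃ F N θ.toStage13Params) (wOfRecord₉ F N θ.toStage9Params) θ.ppSel p (gOfRecord₁₃ F N θ.toStage13Params p) (k + 1) s ≠ 0 →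
      PresentChildObligations θ p k (chainWitness θ p σ k).1 (σ k (chainWitness θ p σ k).1 (chainWitness θ p σ k).2).1 (σ k (chainWitness θ p σ k).1 (chainWitness θ p σ k).2).2 s

/-- **THE NO-EXPANSION OBLIGATION ALONG THE CHAIN** (dag-n11-d's lane): per level `k < K`, given `ChainFormAt θ p σ k`, their `NoExpansionClauseFor` for the chain's level-`k`
witness.  The fifth displayed hypothesis family of `…Sect3SupplyChain.formAtZS_chainWitness`, VERBATIM; DISCHARGED in §5 from the rows. [cite: Balaban1988Convergent, Theorem p.245, (3.24)–(3.25) p.270, (2.17)–(2.18) p.257] -/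
def NoExpansionObligation (σ : Sect3Supplier θ p) : Prop :=
  ∀ k, k < p.K → ChainFormAt θ p σ k → NoExpansionClauseFor θ p k (chainWitness θ p σ k).1 (chainWitness θ p σ k).2

/-- **N11's RESIDUAL AT `(θ, p)` ON THE CHAIN ROAD, ONE TOKEN**: SOME supplier carries its obligations along its own chain ([III] §3) and the no-expansion obligation for that chain
(dag-n11-d's lane).  This — and nothing weaker that the tree knows — gives Theorem 1 ∕ the Theorem of p. 245 at `(θ, p)` on the live-selector line (§4); the older ∀-exposed-witness
pair `NoExpansionTStepAt ∧ Sect3SpliceSupplyAt` (`…Sect3SupplyDefs ∕ …SpliceDefs`) is stronger.  Nothing claimed. [cite: Balaban1988Convergent, Thm 1 p.262, Theorem p.245, §3 p.279 (bookkeeping)] -/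
def SupplyChainAt (θ : Stage13HParams F N) (p : B12.RunParams) : Prop :=
  ∃ σ : Sect3Supplier θ p, SupplierObligations θ p σ ∧ NoExpansionObligation θ p σ

end Obligations

/-! ## §3  The data rows at a no-expansion history: def-T's operand rows for a witness value; the witness-free residual rows (pins, measurability, K0b's domination) -/

section Rows


/-- **def-T ∕ def-R's OPERAND ROWS FOR ONE WITNESS VALUE `(t₀, E₀)` AT A HISTORY `s′` OF LENGTH `k+1`**: for every old branch `S` admissible at `init s′`, the operand
`exp A_k(init s′)[t₀, E₀]` read on the multiscale configuration space is measurable, and it is bounded above.  The last conjunct of dag-n11-d's row list, VERBATIM (owner located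
by them: a `Sect2.TermValues` measurability ∕ bound law of def-T; derivable from term rows by their `…OperandRowsOfTermRows`). [cite: Balaban1988Convergent, (2.20)–(2.23) p.258, (3.16)–(3.21) pp.268–269] -/
def OperandRowsAt (k : ℕ) (s : SeqOfRecord F θ.ν θ.τ9.M (gOfRecord₁₃ F N θ.toStage13Params p) p.K (k + 1)) (t₀ : Sect2.TermValues (F.P p.K) (MatA N) (FluctV N) θ.τ9.M) (E₀ : ℝ) : Prop :=
  ∀ S ∈ admSOfRecord F θ.ν θ.τ9.M (gOfRecord₁₃ F N θ.toStage13Params p) p.K k s.init,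
    Measurable (fun ω : MultiCfg (F.P p.K) (SU N) (FluctV N) =>
      sect2Operand F N (FluctV N) p.K (settingOfRecord₁₃ F N θ.toStage13Params p) (θ.rzAt p s.init) s.init t₀ E₀
          (UbgOfRecord₁₃CoP F N θ.toStage13Params p k s.init) (S, fun j => (ω j).2) (fun j => (ω j).1)) ∧
    ∃ CΦ : ℝ, ∀ a U, sect2Operand F N (FluctV N) p.K (settingOfRecord₁₃ F N θ.toStage13Params p) (θ.rzAt p s.init) s.init t₀ E₀
          (UbgOfRecord₁₃CoP F N θ.toStage13Params p k s.init) a U ≤ CΦ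

/-- **def-T's OPERAND ROWS ALONG THE CHAIN**: per level `k < K`, given `ChainFormAt θ p σ k`, at every no-expansion history with a PRESENT parent, `OperandRowsAt` for the chain's
level-`k` witness value at `init s′`. [cite: Balaban1988Convergent, (2.20)–(2.23) p.258, (3.16)–(3.21) pp.268–269, (3.24) p.270] -/
def OperandRowsAlongChain (σ : Sect3Supplier θ p) : Prop :=
  ∀ k, k < p.K → ChainFormAt θ p σ k →
    ∀ s : SeqOfRecord F θ.ν θ.τ9.M (gOfRecord₁₃ F N θ.toStage13Params p) p.K (k + 1), s.Ω (k + 1) = ∅ →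
      slotsOfRecord F N θ.ν θ.τ9 (EOfRecord₁₃ F N θ.toStage13Params) (wOfRecord₉ F N θ.toStage9Params) θ.ppSel p (gOfRecord₁₃ F N θ.toStage13Params p) k s.init ≠ 0 →
      OperandRowsAt θ p k s ((chainWitness θ p σ k).1 s.init) ((chainWitness θ p σ k).2 s.init)

/-- **THE WITNESS-FREE RESIDUAL ROWS AT A NO-EXPANSION HISTORY `s′` OF LENGTH `k+1`** (dag-n11-d's `…NoExpansionStepSpecification`, every row a property of the DATA `θ.zhAt p s′`,
`WtOfRecord₁₃H θ p s′`): the four pins of the general step ((P) prefix agreement, (V) the generation-`k` pin, `quad_k(∅) = 0`, `k`-locality of `quad_j(Λ_{j+1})`), measurability of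
`ζ0 ∕ quad` of the residual serving `s′`, and per old branch K0b's A-FIBRE DOMINATION (an integrable measurable majorant of the A-fibre weight as a function of the generation-`j`
fluctuation variables).  All but the last conjunct of their row list, VERBATIM. [cite: Balaban1988Convergent, (3.1) p.264, (2.21) p.258, (3.16)–(3.23) pp.268–270; Balaban1989LargeFieldI, (0.2)–(0.3) p.176] -/
def ResidualRowsAt (k : ℕ) (s : SeqOfRecord F θ.ν θ.τ9.M (gOfRecord₁₃ F N θ.toStage13Params p) p.K (k + 1)) : Prop :=
  -- the four pins of the general step: (P), (V), `quad_k(∅) = 0`, `k`-locality of `quad_j(Λ_{j+1})`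
  (∀ j, j < k → (θ.zhAt p s).ζ0 j = (θ.zhAt p s.init).ζ0 j ∧ (θ.zhAt p s).quad j = (θ.zhAt p s.init).quad j) ∧
  (∀ (V' : GaugeField (F.P p.K) (k + 1) (SU N)) (U₀ : GaugeField (F.P p.K) k (SU N)),
    (θ.zhAt p s).ζ0 k Set.univ (pairCfgAt (V := FluctV N) k V' U₀) =
      chiSeqOfRecord F N θ.ν θ.τ9.M (gOfRecord₁₃ F N θ.toStage13Params p) p.K k s.init U₀ *
        wOfRecord₉ F N θ.toStage9Params p (gOfRecord₁₃ F N θ.toStage13Params p) k s U₀ ((avOfRecord F N p.K k).avg U₀)) ∧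
  (∀ (V' : GaugeField (F.P p.K) (k + 1) (SU N)) (U₀ : GaugeField (F.P p.K) k (SU N)), (θ.zhAt p s).quad k ∅ (pairCfgAt (V := FluctV N) k V' U₀) = 0) ∧
  (∀ j, j < k → ∀ ω ω' : MultiCfg (F.P p.K) (SU N) (FluctV N), (∀ i, i ≤ k → ω i = ω' i) →
    (θ.zhAt p s).quad j (s.init.Λ (j + 1)) ω = (θ.zhAt p s).quad j (s.init.Λ (j + 1)) ω') ∧
  -- measurability of the residual serving `s′`
  (∀ j (Y : Set (Site (F.P p.K) 0)), Measurable ((θ.zhAt p s).ζ0 j Y)) ∧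
  (∀ j (Λ' : Set (Site (F.P p.K) 0)), Measurable ((θ.zhAt p s).quad j Λ')) ∧
  -- per old branch: A-fibre domination (K0b)
  (∀ S ∈ admSOfRecord F θ.ν θ.τ9.M (gOfRecord₁₃ F N θ.toStage13Params p) p.K k s.init, ∀ j : ℕ,
    ∃ ŵ : (↥(Set.toFinite (B10Eq42TorusConstraint.bondsIn j ((s.init.Λ (j + 1))ᶜ ∩ s.init.Ω (j + 1)))).toFinset → FluctV N) → ℝ≥0∞, Measurable ŵ ∧
      (∫⁻ a, ŵ a ∂(Measure.pi fun _ : ↥(Set.toFinite (B10Eq42TorusConstraint.bondsIn j ((s.init.Λ (j + 1))ᶜ ∩ s.init.Ω (j + 1)))).toFinset => (volume : Measure (FluctV N)))) ≠ ⊤ ∧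
      ∀ ω, ENNReal.ofReal ((WtOfRecord₁₃H F N θ p s).w j (s.init.Λ (j + 1)) ((s.init.Λ (j + 1))ᶜ ∩ s.init.Ω (j + 1)) (S (j + 1)) ω) ≤
        ŵ (fun b : ↥(Set.toFinite (B10Eq42TorusConstraint.bondsIn j ((s.init.Λ (j + 1))ᶜ ∩ s.init.Ω (j + 1)))).toFinset => (ω j).2 b))

/-- **THE RESIDUAL ROWS OF THE RUN**: `ResidualRowsAt` at every no-expansion history of every length `k+1 ≤ K` with a PRESENT parent (`ρ_k(init s′) ≢ 0`) — witness-free.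
[cite: Balaban1988Convergent, (3.1) p.264, (3.16)–(3.23) pp.268–270 (bookkeeping)] -/
def ResidualRows (θ : Stage13HParams F N) (p : B12.RunParams) : Prop :=
  ∀ k, k < p.K → ∀ s : SeqOfRecord F θ.ν θ.τ9.M (gOfRecord₁₃ F N θ.toStage13Params p) p.K (k + 1), s.Ω (k + 1) = ∅ →
    slotsOfRecord F N θ.ν θ.τ9 (EOfRecord₁₃ F N θ.toStage13Params) (wOfRecord₉ F N θ.toStage9Params) θ.ppSel p (gOfRecord₁₃ F N θ.toStage13Params p) k s.init ≠ 0 →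
    ResidualRowsAt θ p k s

end Rows

/-! ## §4  Theorem 1 along the chain and its 𝐓-image, read through the names -/

section Chain

variable {θ p}

/-- **THE CHAIN HAS THE §2 FORM AT EVERY LEVEL `k ≤ K` FROM THE NAMED OBLIGATIONS** (`…Sect3SupplyChain.formAtZS_chainWitness` read through `SupplierObligations` and
`NoExpansionObligation`), on the live-selector line: core provisos (row `rstep`), selector clause, admissibility, `0 ≤ κ, E₀, B₀`, `1 ≤ M`.
[cite: Balaban1988Convergent, Thm 1 p.262, Theorem p.245, Thm 2 p.263, §3 p.279, (3.24)–(3.25) p.270; Balaban1989LargeFieldI, (0.2)–(0.4) p.176, p.177 (i)–(ii)] -/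
theorem chainFormAt_all_of_obligations (h : θ.Provisos₁₃CoPH F N)
    (hsel : θ.ppSel = ppSelLiveOfRecord F N θ.ν θ.τ9 (EOfRecord₁₃ F N θ.toStage13Params) (wOfRecord₉ F N θ.toStage9Params))
    (hθ : θ.Admissible F N) (hκ : 0 ≤ θ.s2.lf.κ) (hE₀ : 0 ≤ θ.s2.lf.E₀) (hB₀ : 0 ≤ θ.s2.lf.B₀) (hM : 1 ≤ θ.τ9.M) (σ : Sect3Supplier θ p)
    (hσ : SupplierObligations θ p σ) (hT : NoExpansionObligation θ p σ) : ∀ k, k ≤ p.K → ChainFormAt θ p σ k :=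
  formAtZS_chainWitness θ p h hsel hθ hκ hE₀ hB₀ hM σ hσ.univE hσ.newE hσ.present hT

/-- **THE 𝐓-STEP THROUGH THE NAMES**: from `ChainFormAt θ p σ k` (`k < K`) the level-`(k+1)` chain witness is a 𝐓-image witness at level `k` (`…Sect3SupplyChain.formT_spliceTermsB_of_rows`;
`1 ≤ M`, `0 ≤ B₀`). [cite: Balaban1988Convergent, Theorem p.245, §3 p.279, (3.24)–(3.25) p.270, (2.40)–(2.42) p.261] -/
theorem chainFormTAt_of_chainFormAt (hM : 1 ≤ θ.τ9.M) (hB₀ : 0 ≤ θ.s2.lf.B₀) (σ : Sect3Supplier θ p) (hσ : SupplierObligations θ p σ) (hT : NoExpansionObligation θ p σ)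
    {k : ℕ} (hk : k < p.K) (hform : ChainFormAt θ p σ k) : ChainFormTAt θ p σ k :=
  formT_spliceTermsB_of_rows θ p hM hB₀ _ _ hform _ _ (hσ.univE k hk hform) (hσ.newE k hk hform) (hσ.present k hk hform) (hT k hk hform)

/-- **THE CHAIN's 𝐓-IMAGES AT EVERY LEVEL `k < K`** on the live-selector line. [cite: Balaban1988Convergent, Theorem p.245, §3 p.279, (3.24)–(3.25) p.270] -/
theorem chainFormTAt_all_of_obligations (h : θ.Provisos₁₃CoPH F N)
    (hsel : θ.ppSel = ppSelLiveOfRecord F N θ.ν θ.τ9 (EOfRecord₁₃ F N θ.toStage13Params) (wOfRecord₉ F N θ.toStage9Params))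
    (hθ : θ.Admissible F N) (hκ : 0 ≤ θ.s2.lf.κ) (hE₀ : 0 ≤ θ.s2.lf.E₀) (hB₀ : 0 ≤ θ.s2.lf.B₀) (hM : 1 ≤ θ.τ9.M) (σ : Sect3Supplier θ p)
    (hσ : SupplierObligations θ p σ) (hT : NoExpansionObligation θ p σ) : ∀ k, k < p.K → ChainFormTAt θ p σ k := fun k hk =>
  chainFormTAt_of_chainFormAt hM hB₀ σ hσ hT hk (chainFormAt_all_of_obligations h hsel hθ hκ hE₀ hB₀ hM σ hσ hT k hk.le)

/-- **★ THEOREM 1 OF [III] AT `θ`, ALL LEVELS, ALL HISTORIES — `∀ k ≤ K, SLaw₁₃CoPH θ p k` — FROM THE NAMED OBLIGATIONS** (`…Sect3SupplyChain.sLaw₁₃CoPH_all_of_chain` read through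
the names). [cite: Balaban1988Convergent, Thm 1 p.262, Theorem p.245; Balaban1989LargeFieldI, (0.2)–(0.4) p.176] -/
theorem sLaw₁₃CoPH_all_of_obligations (h : θ.Provisos₁₃CoPH F N)
    (hsel : θ.ppSel = ppSelLiveOfRecord F N θ.ν θ.τ9 (EOfRecord₁₃ F N θ.toStage13Params) (wOfRecord₉ F N θ.toStage9Params))
    (hθ : θ.Admissible F N) (hκ : 0 ≤ θ.s2.lf.κ) (hE₀ : 0 ≤ θ.s2.lf.E₀) (hB₀ : 0 ≤ θ.s2.lf.B₀) (hM : 1 ≤ θ.τ9.M) (σ : Sect3Supplier θ p)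
    (hσ : SupplierObligations θ p σ) (hT : NoExpansionObligation θ p σ) : ∀ k, k ≤ p.K → SLaw₁₃CoPH F N θ p k := fun k hk =>
  sLaw₁₃CoPH_of_chainFormAt (chainFormAt_all_of_obligations h hsel hθ hκ hE₀ hB₀ hM σ hσ hT k hk)

/-- **★ THE 𝐓-IMAGES OF [III]'s THEOREM p. 245 AT `θ`, ALL LEVELS — `∀ k < K, TLaw₁₃CoPH θ p k` — FROM THE NAMED OBLIGATIONS**: along the chain the «corresponding space»
clause is WITNESSED (by the splice), not merely implied. [cite: Balaban1988Convergent, Theorem p.245, remark p.262, §3 p.279, (3.25) p.270] -/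
theorem tLaw₁₃CoPH_all_of_obligations (h : θ.Provisos₁₃CoPH F N)
    (hsel : θ.ppSel = ppSelLiveOfRecord F N θ.ν θ.τ9 (EOfRecord₁₃ F N θ.toStage13Params) (wOfRecord₉ F N θ.toStage9Params))
    (hθ : θ.Admissible F N) (hκ : 0 ≤ θ.s2.lf.κ) (hE₀ : 0 ≤ θ.s2.lf.E₀) (hB₀ : 0 ≤ θ.s2.lf.B₀) (hM : 1 ≤ θ.τ9.M) (σ : Sect3Supplier θ p)
    (hσ : SupplierObligations θ p σ) (hT : NoExpansionObligation θ p σ) : ∀ k, k < p.K → TLaw₁₃CoPH F N θ p k := fun k hk =>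
  tLaw₁₃CoPH_of_chainFormTAt (chainFormTAt_all_of_obligations h hsel hθ hκ hE₀ hB₀ hM σ hσ hT k hk)

/-- **★ THE THEOREM OF p. 245 IN LAW FORM — `∀ k < K, SLaw₁₃CoPH θ p k → TLaw₁₃CoPH θ p k` — FROM THE NAMED OBLIGATIONS** (the input of every node dictionary:
`B14NodeKnitRecord13RCoPH.thmP245PrintedI_at_record₁₃CoPH_iff_laws`, `…LiveCoPH.densitiesDescribed_at_record₁₃CoPH_of_laws`, def-T's `thm1Printed_datumOfRecord₁₃CoPH_of_tLaw_rOpLeaf`);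
the antecedent is not even read — the chain carries its own witness. [cite: Balaban1988Convergent, Theorem p.245, Thm 1 p.262, remark p.262] -/
theorem thmP245Laws_of_obligations (h : θ.Provisos₁₃CoPH F N)
    (hsel : θ.ppSel = ppSelLiveOfRecord F N θ.ν θ.τ9 (EOfRecord₁₃ F N θ.toStage13Params) (wOfRecord₉ F N θ.toStage9Params))
    (hθ : θ.Admissible F N) (hκ : 0 ≤ θ.s2.lf.κ) (hE₀ : 0 ≤ θ.s2.lf.E₀) (hB₀ : 0 ≤ θ.s2.lf.B₀) (hM : 1 ≤ θ.τ9.M) (σ : Sect3Supplier θ p)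
    (hσ : SupplierObligations θ p σ) (hT : NoExpansionObligation θ p σ) : ∀ k, k < p.K → SLaw₁₃CoPH F N θ p k → TLaw₁₃CoPH F N θ p k :=
  fun k hk _ => tLaw₁₃CoPH_all_of_obligations h hsel hθ hκ hE₀ hB₀ hM σ hσ hT k hk

/-- **★ THEOREM 1 OF [III] AT `θ` FROM N11's ONE-TOKEN RESIDUAL `SupplyChainAt θ p`** on the live-selector line. [cite: Balaban1988Convergent, Thm 1 p.262, Theorem p.245; Balaban1989LargeFieldI, (0.2)–(0.4) p.176] -/
theorem sLaw₁₃CoPH_all_of_supplyChainAt (h : θ.Provisos₁₃CoPH F N)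
    (hsel : θ.ppSel = ppSelLiveOfRecord F N θ.ν θ.τ9 (EOfRecord₁₃ F N θ.toStage13Params) (wOfRecord₉ F N θ.toStage9Params))
    (hθ : θ.Admissible F N) (hκ : 0 ≤ θ.s2.lf.κ) (hE₀ : 0 ≤ θ.s2.lf.E₀) (hB₀ : 0 ≤ θ.s2.lf.B₀) (hM : 1 ≤ θ.τ9.M) (hN : SupplyChainAt θ p) :
    ∀ k, k ≤ p.K → SLaw₁₃CoPH F N θ p k := by
  obtain ⟨σ, hσ, hT⟩ := hN
  exact sLaw₁₃CoPH_all_of_obligations h hsel hθ hκ hE₀ hB₀ hM σ hσ hT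

/-- **★ THE THEOREM OF p. 245 IN LAW FORM AT `θ` FROM N11's ONE-TOKEN RESIDUAL `SupplyChainAt θ p`** on the live-selector line — the `h11`-consequent of the K1 knit.
[cite: Balaban1988Convergent, Theorem p.245, Thm 1 p.262, remark p.262] -/
theorem thmP245Laws_of_supplyChainAt (h : θ.Provisos₁₃CoPH F N)
    (hsel : θ.ppSel = ppSelLiveOfRecord F N θ.ν θ.τ9 (EOfRecord₁₃ F N θ.toStage13Params) (wOfRecord₉ F N θ.toStage9Params))
    (hθ : θ.Admissible F N) (hκ : 0 ≤ θ.s2.lf.κ) (hE₀ : 0 ≤ θ.s2.lf.E₀) (hB₀ : 0 ≤ θ.s2.lf.B₀) (hM : 1 ≤ θ.τ9.M) (hN : SupplyChainAt θ p) :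
    ∀ k, k < p.K → SLaw₁₃CoPH F N θ p k → TLaw₁₃CoPH F N θ p k := by
  obtain ⟨σ, hσ, hT⟩ := hN
  exact thmP245Laws_of_obligations h hsel hθ hκ hE₀ hB₀ hM σ hσ hT

end Chain

/-! ## §5  Discharging the no-expansion obligation: from the residual + operand rows (dag-n11-d), or at a Gaussian certificate from the operand rows alone (dag-n11-w1) -/

section Discharge

variable {θ p}

/-- **`NoExpansionObligation` FROM THE ROWS** (`…ChainRows` §1 read through the names): core provisos, `ZhUnity`, `1 ≤ M`, the supplier's locality (loc), `ResidualRows θ p`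
(witness-free) and `OperandRowsAlongChain θ p σ`. [cite: Balaban1988Convergent, Theorem p.245, (3.24)–(3.25) p.270, (3.1) p.264, (3.16)–(3.21) pp.268–269; Balaban1989LargeFieldI, (0.2)–(0.3) p.176] -/
theorem noExpansionObligation_of_residualRows_of_operandRows (h : θ.Provisos₁₃CoPH F N) (hU : θ.ZhUnity F N) (hM : 1 ≤ θ.τ9.M) (σ : Sect3Supplier θ p)
    (hloc : ∀ k (s : SeqOfRecord F θ.ν θ.τ9.M (gOfRecord₁₃ F N θ.toStage13Params p) p.K (k + 1)), IsFluctLocal (k + 1) ((σ k (chainWitness θ p σ k).1 (chainWitness θ p σ k).2).1 s))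
    (hres : ResidualRows θ p) (hops : OperandRowsAlongChain θ p σ) : NoExpansionObligation θ p σ := fun k hk hform =>
  noExpansionClauseFor_of_form_of_local_of_rows θ p h hU hk hM _ _ hform (fun s₀ => isFluctLocal_chainWitness θ p σ hloc k s₀) fun s hΩ h0 =>
    have hr := hres k hk s hΩ h0
    ⟨hr.1, hr.2.1, hr.2.2.1, hr.2.2.2.1, hr.2.2.2.2.1, hr.2.2.2.2.2.1, hr.2.2.2.2.2.2, hops k hk hform s hΩ h0⟩

/-- **★★ `NoExpansionObligation` AT ANY `θ` OF THE GAUSSIAN CERTIFICATE CLASS FROM THE OPERAND ROWS ALONE** (dag-n11-w1's witness-keyed `clause_succ_of_gaussCert_of_witness`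
at the chain's witness; absent parents by p580585's zero child): certificate `ζ0`, A-fibre Gaussian `quad`, core provisos, `1 ≤ M`, the supplier's locality (loc),
`OperandRowsAlongChain θ p σ` — NO `ZhUnity`, NO residual row, NO K0b row. [cite: Balaban1988Convergent, Theorem p.245, Thm 1 p.262, (3.24)–(3.25) p.270, (3.23) p.270, (2.23) p.258] -/
theorem noExpansionObligation_of_gaussCert_of_operandRows
    (hζ : ∀ (p : B12.RunParams) (n : ℕ) (Ω Λ : ℕ → Set (Site (F.P p.K) 0)), (θ.Zh p n Ω Λ).ζ0 = (ZhPinOfRecord₁₃ θ.toStage13Params p Ω Λ).ζ0)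
    (hq : ∀ (p : B12.RunParams) (n : ℕ) (Ω Λ : ℕ → Set (Site (F.P p.K) 0)) (j : ℕ) (Λ' : Set (Site (F.P p.K) 0)) (ω : MultiCfg (F.P p.K) (SU N) (FluctV N)),
      (θ.Zh p n Ω Λ).quad j Λ' ω = ∑ b ∈ (Set.toFinite (bondsIn j (Λ'ᶜ ∩ Ω (j + 1)))).toFinset, ‖(ω j).2 b‖ ^ 2)
    (h : θ.Provisos₁₃CoPH F N) (hM : 1 ≤ θ.τ9.M) (σ : Sect3Supplier θ p)
    (hloc : ∀ k (s : SeqOfRecord F θ.ν θ.τ9.M (gOfRecord₁₃ F N θ.toStage13Params p) p.K (k + 1)), IsFluctLocal (k + 1) ((σ k (chainWitness θ p σ k).1 (chainWitness θ p σ k).2).1 s))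
    (hops : OperandRowsAlongChain θ p σ) : NoExpansionObligation θ p σ := fun k hk hform s hΩ => by
  by_cases h0 : slotsOfRecord F N θ.ν θ.τ9 (EOfRecord₁₃ F N θ.toStage13Params) (wOfRecord₉ F N θ.toStage9Params) θ.ppSel p (gOfRecord₁₃ F N θ.toStage13Params p) k s.init = 0
  · exact Or.inl (slotsTOfRecord₁₃H_succ_eq_zero_of_init_eq_zero θ p s h0)
  exact clause_succ_of_gaussCert_of_witness θ p hζ hq h hk hM s hΩ _ _ (isFluctLocal_chainWitness θ p σ hloc k s.init) (hform.2 s.init).2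
    (hops k hk hform s hΩ h0)

end Discharge

end Summit.QuantumFields.YangMills.Theorems.BalabanUVNodesN11Sect3SupplyChainObligationsDefs

end
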